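import Summits.QuantumFields.BalabanUV.Beta.D1BFx.CoarseLeg
import Literature.MathematicalPhysics.QuantumFieldTheory.Balaban1983to89.Beta.HessKerRate

/-!
# `BalabanUV.Beta.D1BFx.UnitLoopCount` — road «BF-x» for binder row D1, sub-leaf A5.0: «NO FINE LOOP ⇒ NO `log n`» AS A KERNEL THEOREM —
# a one-loop kernel on the UNIT lattice whose legs are the coarse leg `Cun n a` (T3: `n`-UNIFORM exponential decay, unconditional) and whose
# vertices are `n`-uniformly localised coarse vertex families has every (1.22)-moment bounded by an EXPLICIT function of `(a, Cv, Cw, δ)`,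
# the same for every block size `n`

HONEST FRAMING (cell contract, verbatim): «discharging `BetaPertH` makes Bałaban's UV stability UNCONDITIONAL — a real constructive-QFT
result; it is NOT the continuum limit and NOT the Clay problem.»  HONEST DEPENDENCY (verbatim): «continuum YM on T⁴ ⇐ BetaPertH ∧ nine
spine estimates (0/9 proved); BetaPertH ⇐ (D1) ∧ (D4) ∧ CAP+tail; G-an2-4 gates asym, D1 and NE2/3/4.»  THIS MODULE DISCHARGES NOTHING.
[folklore] composition BY NAME of T3's `D1BFx.CoarseLeg.decays_Cun` (unconditional, `n`-uniform), an5's `HessKerRate.decay510_hessKer_explicit`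
(the explicit constant `hessConst`) and b03's `B12Sec2to5.secondMoment_abs_le_of_decay510` (`betaPrime510`).  No `Prop` is minted, no `def`,
nothing printed is asserted, 0 sorry.  NOT summit progress; NOT BetaPertH, NOT continuum, NOT Clay.

ABSOLUTE RULE (cell, verbatim): «No internally-minted statement may enter as a cited fact. Every hypothesis is either kernel-proved in this
package or a verbatim quotation of a PUBLISHED theorem with page reference. The manuscript(s) under audit are NOT citable for their own
disputed steps — they are the thing under adjudication; programme-internal (2001/route/tribunal) claims are never citable.»

WHY (skeleton `HOME/beta/skeletons/D1-b2b-balaban-beta-d1-p2.md` v1.4 node A, leaf A5 «UNIT PIECES: `|secondMoment (Hess_B 𝒰_n) μ ν| ≤ C`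
uniformly: coarse-lattice bubble/tadpole with legs L5 (n-uniform exponential decay on the unit lattice) and coarse vertices … NO fine loop ⇒
no `log n`»; A0 TERM CENSUS row «unit»; claim table `LEAVES-BFx.md` row A5, SUB-LEAF A5.0).  Row A5 splits into (A5.0) the COUNT — THIS FILE:
for ANY first/second-order vertex families on the unit lattice with `n`-free localisation data, the loop over `Cun n a` has `n`-free bounded
moments — and (A5.1) the IDENTIFICATION + VERTEX BOUNDS — the `B`-Hessian of the unit piece `𝒰_n` IS such a loop and the `B`-jets of
`Q_n(U_B) G(U_B) Q_n(U_B)*` ARE such families (J6 + (α)-leaves; OPEN, not here).  Unlike the gluon leg (T1, whose decay is an (α)-binder),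
the coarse leg's decay is a TREE THEOREM for every `n` (`decays_Cun`, from t4-ne2-p2's `kerRe_decay`), so A5.0 carries NO leg-side hypothesis.

CONTENT (all [folklore]).
* (coarse vertex families are plain `V : Fin 4 → Site 4 → MKer 4 (Fin 4)`, tables `W : Fin 4 → Site 4 → Fin 4 → Site 4 → MKer 4 (Fin 4)`.)
* §1 `blockCovariant_Cun` (unit-lattice covariance of the data ⇒ `BlockCovariant (Cun n a) V W 1`), `hess_Cun_eq_hessKer` (base point).
* §2 fixed `n`: `decay510_unitLoop` (`Decay510 (hessKer (Cun n a) V W μ ν) (hessConst 4 4 δ (c166Z 3 + |a|) Cv Cw) (δ/4)`),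
  `abs_secondMoment_unitLoop_le` (`≤ betaPrime510 4 (hessConst 4 4 δ (c166Z 3 + |a|) Cv Cw) (δ/4)`), `summable_secondMoment_unitLoop`,
  `absMoment₂_unitLoop` (any positive vertex rates).
* §3 families `n = Lc^m`: `abs_secondMoment_unitLoop_family_le` / `exists_uniform_bound_unitLoop` — the A5 END SHAPE
  `∃ U, ∀ m, |secondMoment (hessKer (Cun (Lc^m) a) (V m) (W m)) μ ν| ≤ U` under `m`-uniform vertex data (modulo A5.1).
-/

noncomputable section

namespace Summit.QuantumFields.BalabanUV.Beta.D1BFx.UnitLoopCount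

open Literature.MathematicalPhysics.QuantumFieldTheory.Balaban1983to89
open Literature.MathematicalPhysics.QuantumFieldTheory.Balaban1983to89.Beta
open B12Sec2to5 (l1 l1_nonneg Decay510 betaPrime510 secondMoment_abs_le_of_decay510)
open ExpKernelCalculus (Site MKer Decays BiLoc VertexFamily VertexFamily₂ shiftK BlockCovariant hess hessKer hess_eq_hessKer
  absMoment₂_hessKer)
open DecimatedMomentSummable (AbsMoment₂)
open OneStepResolventKernel (decays_mono biLoc_mono)
open HessKerRate (hessConst decay510_hessKer_explicit)
open B5Symbol166Strip (MG_pos)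
open Summit.QuantumFields.BalabanUV.Beta.GAN24.DirichletExhaustionDeltaZ (c166Z kappaZ kappaZ_pos)
open Summit.QuantumFields.BalabanUV.Beta.D1BFx.CoarseLeg (Cun decays_Cun shiftK_Cun)

variable (n : ℕ) [NeZero n] (a : ℝ)

/-! ## §1 Unit-lattice covariance: the base point `0` represents every base point -/

/-- [folklore] `BlockCovariant (Cun n a) V W 1` for unit-lattice-covariant vertex families (`covA` = T3's `shiftK_Cun` at EVERY translation). -/
theorem blockCovariant_Cun {V : Fin 4 → Site 4 → MKer 4 (Fin 4)} {W : Fin 4 → Site 4 → Fin 4 → Site 4 → MKer 4 (Fin 4)}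
    (hV : ∀ (μ : Fin 4) (y t : Site 4), V μ (y + t) = shiftK (-(((1 : ℕ) : ℤ) • t)) (V μ y))
    (hW : ∀ (μ : Fin 4) (y : Site 4) (ν : Fin 4) (y' t : Site 4), W μ (y + t) ν (y' + t) = shiftK (-(((1 : ℕ) : ℤ) • t)) (W μ y ν y')) :
    BlockCovariant (Cun n a) V W 1 :=
  ⟨fun _ => shiftK_Cun n a _, hV, hW⟩

/-- [folklore] **BASE POINT**: `hess (Cun n a) V W μ y ν y′ = hessKer (Cun n a) V W μ ν (y′ − y)` for unit-lattice-covariant vertex families. -/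
theorem hess_Cun_eq_hessKer {V : Fin 4 → Site 4 → MKer 4 (Fin 4)} {W : Fin 4 → Site 4 → Fin 4 → Site 4 → MKer 4 (Fin 4)}
    (hV : ∀ (μ : Fin 4) (y t : Site 4), V μ (y + t) = shiftK (-(((1 : ℕ) : ℤ) • t)) (V μ y))
    (hW : ∀ (μ : Fin 4) (y : Site 4) (ν : Fin 4) (y' t : Site 4), W μ (y + t) ν (y' + t) = shiftK (-(((1 : ℕ) : ℤ) • t)) (W μ y ν y'))
    (μ : Fin 4) (y : Site 4) (ν : Fin 4) (y' : Site 4) :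
    hess (Cun n a) V W μ y ν y' = hessKer (Cun n a) V W μ ν (y' - y) :=
  hess_eq_hessKer (blockCovariant_Cun n a hV hW) μ y ν y'

/-! ## §2 Fixed block size: decay and moment bound with constants free of `n` -/

section Fixed

variable {V : Fin 4 → Site 4 → MKer 4 (Fin 4)} {W : Fin 4 → Site 4 → Fin 4 → Site 4 → MKer 4 (Fin 4)} {Cv Cw δ : ℝ}

omit [NeZero n] in
/-- [folklore] the coarse leg's decay constant is nonnegative (`c166Z 3 = 4·4²·MG 4 > 0`). -/
theorem coarseConst_nonneg : 0 ≤ c166Z 3 + |a| := by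
  have h1 : 0 ≤ c166Z 3 := by
    have := MG_pos (3 + 1)
    simp only [c166Z]
    positivity
  positivity

/-- [folklore] The coarse leg at a SMALLER rate `δ ≤ kappaZ 3` (monotonicity), for every `n`. -/
theorem decays_Cun_of_le (hδ : δ ≤ kappaZ 3) : Decays (Cun n a) (c166Z 3 + |a|) δ :=
  decays_mono (decays_Cun n a) (coarseConst_nonneg a) le_rfl hδ

/-- [folklore] **(5.10)-SHAPE DECAY OF THE UNIT-LATTICE LOOP, CONSTANT FREE OF `n`**: for vertex families on the unit lattice (blocking `1`)
with data `(Cv, δ)`, `(Cw, δ)`, `0 < δ ≤ kappaZ 3`:  `|hessKer (Cun n a) V W μ ν z| ≤ hessConst 4 4 δ (c166Z 3 + |a|) Cv Cw · e^{−(δ/4)|z|₁}`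
for EVERY block size `n` — UNCONDITIONAL on the leg side (T3's `decays_Cun`). -/
theorem decay510_unitLoop (hV : VertexFamily V 1 Cv δ) (hW : VertexFamily₂ W 1 Cw δ) (hδ : 0 < δ) (hδ' : δ ≤ kappaZ 3)
    (μ ν : Fin 4) : Decay510 (hessKer (Cun n a) V W μ ν) (hessConst 4 4 δ (c166Z 3 + |a|) Cv Cw) (δ / 4) := by
  have h := decay510_hessKer_explicit (decays_Cun_of_le n a hδ') hV hW hδ le_rfl μ ν
  simpa [Fintype.card_fin] using h

/-- [folklore] **«NO FINE LOOP ⇒ NO `log n`»**: `|secondMoment (hessKer (Cun n a) V W) μ ν| ≤ betaPrime510 4 (hessConst 4 4 δ (c166Z 3 + |a|) Cv Cw) (δ/4)`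
for EVERY `n` — the bound is a function of `(a, Cv, Cw, δ)` only. -/
theorem abs_secondMoment_unitLoop_le (hV : VertexFamily V 1 Cv δ) (hW : VertexFamily₂ W 1 Cw δ) (hδ : 0 < δ) (hδ' : δ ≤ kappaZ 3)
    (μ ν : Fin 4) :
    |B12Beta.secondMoment (hessKer (Cun n a) V W) μ ν| ≤ betaPrime510 4 (hessConst 4 4 δ (c166Z 3 + |a|) Cv Cw) (δ / 4) :=
  (secondMoment_abs_le_of_decay510 (P := hessKer (Cun n a) V W) (by positivity) (decay510_unitLoop n a hV hW hδ hδ' μ ν)).2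

/-- [folklore] … and the (1.22) integrand is summable. -/
theorem summable_secondMoment_unitLoop (hV : VertexFamily V 1 Cv δ) (hW : VertexFamily₂ W 1 Cw δ) (hδ : 0 < δ) (hδ' : δ ≤ kappaZ 3)
    (μ ν : Fin 4) : Summable (fun x : Site 4 => hessKer (Cun n a) V W μ ν x * (x μ : ℝ) * (x ν : ℝ)) :=
  (secondMoment_abs_le_of_decay510 (P := hessKer (Cun n a) V W) (by positivity) (decay510_unitLoop n a hV hW hδ hδ' μ ν)).1

/-- [folklore] `AbsMoment₂` of every channel, for vertex families at ANY positive rates (matched by monotonicity to `kappaZ 3`). -/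
theorem absMoment₂_unitLoop {δv δ2 : ℝ} (hV : VertexFamily V 1 Cv δv) (hδv : 0 < δv) (hW : VertexFamily₂ W 1 Cw δ2) (hδ2 : 0 < δ2)
    (μ ν : Fin 4) : AbsMoment₂ (hessKer (Cun n a) V W μ ν) := by
  have hCv : 0 ≤ Cv := (hV μ 0).nonneg 0
  have hCw : 0 ≤ Cw := (hW μ 0 ν 0).nonneg 0
  set δ' : ℝ := min (kappaZ 3) (min δv δ2) with hδ'
  have hδ'pos : 0 < δ' := lt_min (kappaZ_pos 3) (lt_min hδv hδ2)
  have hA' : Decays (Cun n a) (c166Z 3 + |a|) δ' := decays_Cun_of_le n a (min_le_left _ _)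
  have hV' : VertexFamily V 1 Cv δ' := fun μ' y =>
    biLoc_mono (hV μ' y) hCv ((min_le_right _ _).trans (min_le_left _ _))
  have hW' : VertexFamily₂ W 1 Cw δ' := fun μ' y ν' y' =>
    biLoc_mono (hW μ' y ν' y') hCw ((min_le_right _ _).trans (min_le_right _ _))
  exact absMoment₂_hessKer hA' hV' hW' hδ'pos le_rfl μ ν

end Fixed

/-! ## §3 Families along the scale ladder `n = Lc^m`: the A5 end shape (modulo A5.1) -/

section Family

variable (Lc : ℕ) [NeZero Lc] {V : ℕ → Fin 4 → Site 4 → MKer 4 (Fin 4)}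
  {W : ℕ → Fin 4 → Site 4 → Fin 4 → Site 4 → MKer 4 (Fin 4)} {Cv Cw δ : ℝ}

/-- [folklore] **UNIFORM ALONG THE LADDER**: if the coarse vertex families of the unit pieces at `n = Lc^m` carry `m`-UNIFORM data
`(Cv, δ)`, `(Cw, δ)` with `0 < δ ≤ kappaZ 3`, then for every `m`
`|secondMoment (hessKer (Cun (Lc^m) a) (V m) (W m)) μ ν| ≤ betaPrime510 4 (hessConst 4 4 δ (c166Z 3 + |a|) Cv Cw) (δ/4)` — one bound for all `m`. -/
theorem abs_secondMoment_unitLoop_family_le (hV : ∀ m, VertexFamily (V m) 1 Cv δ) (hW : ∀ m, VertexFamily₂ (W m) 1 Cw δ)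
    (hδ : 0 < δ) (hδ' : δ ≤ kappaZ 3) (μ ν : Fin 4) (m : ℕ) :
    |B12Beta.secondMoment (hessKer (Cun (Lc ^ m) a) (V m) (W m)) μ ν| ≤
      betaPrime510 4 (hessConst 4 4 δ (c166Z 3 + |a|) Cv Cw) (δ / 4) :=
  abs_secondMoment_unitLoop_le (Lc ^ m) a (hV m) (hW m) hδ hδ' μ ν

/-- [folklore] **THE A5 END SHAPE (modulo A5.1)**: `∃ U, ∀ m, |secondMoment (hessKer (Cun (Lc^m) a) (V m) (W m)) μ ν| ≤ U` under `m`-uniform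
coarse vertex data — the unit pieces contribute `O(1)` to the one-shot coefficient, never `log n`. -/
theorem exists_uniform_bound_unitLoop (hV : ∀ m, VertexFamily (V m) 1 Cv δ) (hW : ∀ m, VertexFamily₂ (W m) 1 Cw δ)
    (hδ : 0 < δ) (hδ' : δ ≤ kappaZ 3) (μ ν : Fin 4) :
    ∃ U : ℝ, ∀ m : ℕ, |B12Beta.secondMoment (hessKer (Cun (Lc ^ m) a) (V m) (W m)) μ ν| ≤ U :=
  ⟨_, abs_secondMoment_unitLoop_family_le a Lc hV hW hδ hδ' μ ν⟩

end Family

end Summit.QuantumFields.BalabanUV.Beta.D1BFx.UnitLoopCount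

end
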